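import Mathlib
import Summits.Ventures.PercRepro2.HCov
import Summits.Ventures.PercRepro2.HCovCubic
import Summits.Ventures.PercRepro2.TriDisagreement
import Summits.Ventures.PercRepro2.TriDisagreementPinned
import Summits.Ventures.PercRepro2.TypedSplit
import Summits.Ventures.PercRepro2.OneTypedEdge
import Summits.Ventures.PercRepro2.StarPattern

/-!
# The star of a degree-four unmarked vertex: pattern counts, pendant copies, the 81-placement split
(blind cell PercRepro2, p1 g12; the degree-4 sibling of `StarPattern.lean`, ASSIGNMENTS v12.27
(6′) / LEAD-CCW (c⁗⁗⁗) «degree 4 in the multi-state language»)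

At an unmarked vertex `y` of degree four with star edges `s₁, s₂, s₃, s₄` (to `u₁, u₂, u₃, u₄`;
labels `0, 1, 2, 3`), the typed count with the star edges of type `1` splits (`typedCount_split`
four times) into the `3⁴ = 81` placements of a PATTERN count `patCount4 U₀ U₁ U₂`
(`U_c ∈ Bool⁴` = the star edges open in copy `c`): **`typedCount_star4_split`**. A copy with
exactly one open star edge has `y` pendant there, hence invisible to the marks
(`conn_update_false_pendant`), and may be closed (`patCount4_close_x` / `_y` / `_w`).
`StarFourIdentity.lean` sorts the 81 placements into the lead's identity
`N_(1,1,1,1) = B(Q₁) + 2 Σ_i B(T_i₁) + 2 Σ_p B(p₁) + Σ_pairings Λ(p; p̄; ∅)` and names DEG4.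
-/

namespace Summit.Ventures.PercRepro2

open CovForm CovForm.OneTyped CovForm.TypedRed

namespace StarFour

/-! ## Pattern counts at a degree-four star -/

section Pattern

variable {V : Type*} {E : Type*} [Fintype E] [DecidableEq E] {R : Type*} [Field R]

/-- The configuration with the star `s₁, s₂, s₃, s₄` set to `U = (b₁, b₂, b₃, b₄)`. -/
def starSet4 (s₁ s₂ s₃ s₄ : E) (U : Bool × Bool × Bool × Bool) (x : Config E) : Config E :=
  Function.update (Function.update (Function.update (Function.update x s₄ U.2.2.2) s₃ U.2.2.1) s₂
    U.2.1) s₁ U.1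

/-- The pattern kernel: `K₃` on the three copies with the star set to `U₀, U₁, U₂`. -/
noncomputable def patKernel4 (ends : E → Sym2 V) (o a₁ a₂ a₃ b : V) (s₁ s₂ s₃ s₄ : E)
    (U₀ U₁ U₂ : Bool × Bool × Bool × Bool) : Config E → Config E → Config E → R :=
  fun x y w => K3 ends o a₁ a₂ a₃ b (starSet4 s₁ s₂ s₃ s₄ U₀ x) (starSet4 s₁ s₂ s₃ s₄ U₁ y)
    (starSet4 s₁ s₂ s₃ s₄ U₂ w)

/-- The pattern count: the typed count over `F₀` (the star removed) of the pattern kernel. -/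
noncomputable def patCount4 (ends : E → Sym2 V) (o a₁ a₂ a₃ b : V) (s₁ s₂ s₃ s₄ : E)
    (F₀ : Finset E) (z₀ : Config E) (τ : E → ℕ) (U₀ U₁ U₂ : Bool × Bool × Bool × Bool) : R :=
  typedCount F₀ z₀ τ (patKernel4 ends o a₁ a₂ a₃ b s₁ s₂ s₃ s₄ U₀ U₁ U₂)

omit [Fintype E] in
/-- `starSet4` is the explicit four-way update. -/
lemma starSet4_apply {s₁ s₂ s₃ s₄ : E} (h12 : s₁ ≠ s₂) (h13 : s₁ ≠ s₃) (h14 : s₁ ≠ s₄)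
    (h23 : s₂ ≠ s₃) (h24 : s₂ ≠ s₄) (h34 : s₃ ≠ s₄) (U : Bool × Bool × Bool × Bool) (x : Config E)
    (g : E) :
    starSet4 s₁ s₂ s₃ s₄ U x g =
      if g = s₁ then U.1 else if g = s₂ then U.2.1 else if g = s₃ then U.2.2.1
        else if g = s₄ then U.2.2.2 else x g := by
  unfold starSet4
  by_cases hg1 : g = s₁
  · subst hg1; simp
  by_cases hg2 : g = s₂
  · subst hg2; simp [h12.symm]
  by_cases hg3 : g = s₃
  · subst hg3; simp [h13.symm, h23.symm]
  by_cases hg4 : g = s₄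
  · subst hg4; simp [h14.symm, h24.symm, h34.symm]
  simp [hg1, hg2, hg3, hg4]

end Pattern

/-! ## Closing a pendant copy -/

section Close

variable {V : Type*} {E : Type*} [DecidableEq E] {R : Type*} [Field R]

/-- Closing `s₁` in the star configuration `(true, false, false, false)` gives the closed star. -/
lemma update_starSet4_one {s₁ s₂ s₃ s₄ : E} (h12 : s₁ ≠ s₂) (h13 : s₁ ≠ s₃) (h14 : s₁ ≠ s₄)
    (h23 : s₂ ≠ s₃) (h24 : s₂ ≠ s₄) (h34 : s₃ ≠ s₄) (x : Config E) :
    Function.update (starSet4 s₁ s₂ s₃ s₄ (true, false, false, false) x) s₁ false =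
      starSet4 s₁ s₂ s₃ s₄ (false, false, false, false) x := by
  funext g
  by_cases hg : g = s₁
  · subst hg; simp [starSet4_apply h12 h13 h14 h23 h24 h34]
  · rw [Function.update_of_ne hg, starSet4_apply h12 h13 h14 h23 h24 h34,
      starSet4_apply h12 h13 h14 h23 h24 h34, if_neg hg, if_neg hg]

/-- Closing `s₂` in the star configuration `(false, true, false, false)` gives the closed star. -/
lemma update_starSet4_two {s₁ s₂ s₃ s₄ : E} (h12 : s₁ ≠ s₂) (h13 : s₁ ≠ s₃) (h14 : s₁ ≠ s₄)
    (h23 : s₂ ≠ s₃) (h24 : s₂ ≠ s₄) (h34 : s₃ ≠ s₄) (x : Config E) :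
    Function.update (starSet4 s₁ s₂ s₃ s₄ (false, true, false, false) x) s₂ false =
      starSet4 s₁ s₂ s₃ s₄ (false, false, false, false) x := by
  funext g
  by_cases hg : g = s₂
  · subst hg; simp [starSet4_apply h12 h13 h14 h23 h24 h34, h12.symm]
  · rw [Function.update_of_ne hg, starSet4_apply h12 h13 h14 h23 h24 h34,
      starSet4_apply h12 h13 h14 h23 h24 h34]
    by_cases hg1 : g = s₁
    · simp [hg1]
    · rw [if_neg hg1, if_neg hg1, if_neg hg, if_neg hg]

/-- Closing `s₃` in the star configuration `(false, false, true, false)` gives the closed star. -/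
lemma update_starSet4_three {s₁ s₂ s₃ s₄ : E} (h12 : s₁ ≠ s₂) (h13 : s₁ ≠ s₃) (h14 : s₁ ≠ s₄)
    (h23 : s₂ ≠ s₃) (h24 : s₂ ≠ s₄) (h34 : s₃ ≠ s₄) (x : Config E) :
    Function.update (starSet4 s₁ s₂ s₃ s₄ (false, false, true, false) x) s₃ false =
      starSet4 s₁ s₂ s₃ s₄ (false, false, false, false) x := by
  funext g
  by_cases hg : g = s₃
  · subst hg; simp [starSet4_apply h12 h13 h14 h23 h24 h34, h13.symm, h23.symm]
  · rw [Function.update_of_ne hg, starSet4_apply h12 h13 h14 h23 h24 h34,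
      starSet4_apply h12 h13 h14 h23 h24 h34]
    by_cases hg1 : g = s₁
    · simp [hg1]
    · by_cases hg2 : g = s₂
      · simp [hg2]
      · rw [if_neg hg1, if_neg hg1, if_neg hg2, if_neg hg2, if_neg hg, if_neg hg]

/-- Closing `s₄` in the star configuration `(false, false, false, true)` gives the closed star. -/
lemma update_starSet4_four {s₁ s₂ s₃ s₄ : E} (h12 : s₁ ≠ s₂) (h13 : s₁ ≠ s₃) (h14 : s₁ ≠ s₄)
    (h23 : s₂ ≠ s₃) (h24 : s₂ ≠ s₄) (h34 : s₃ ≠ s₄) (x : Config E) :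
    Function.update (starSet4 s₁ s₂ s₃ s₄ (false, false, false, true) x) s₄ false =
      starSet4 s₁ s₂ s₃ s₄ (false, false, false, false) x := by
  funext g
  by_cases hg : g = s₄
  · subst hg; simp [starSet4_apply h12 h13 h14 h23 h24 h34, h14.symm, h24.symm, h34.symm]
  · rw [Function.update_of_ne hg, starSet4_apply h12 h13 h14 h23 h24 h34,
      starSet4_apply h12 h13 h14 h23 h24 h34]
    by_cases hg1 : g = s₁
    · simp [hg1]
    · by_cases hg2 : g = s₂
      · simp [hg2]
      · by_cases hg3 : g = s₃
        · simp [hg3]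
        · rw [if_neg hg1, if_neg hg1, if_neg hg2, if_neg hg2, if_neg hg3, if_neg hg3, if_neg hg,
            if_neg hg]

/-- **A pendant copy may be closed**: on a configuration `x` with the star closed and every other
edge at `y` a loop or closed, the state of `starSet4 U x` for a singleton `U` is the state of the
closed star. -/
theorem st_starSet4_single (ends : E → Sym2 V) (o a₁ a₂ a₃ b : V) {s₁ s₂ s₃ s₄ : E}
    {y u₁ u₂ u₃ u₄ : V} (h12 : s₁ ≠ s₂) (h13 : s₁ ≠ s₃) (h14 : s₁ ≠ s₄) (h23 : s₂ ≠ s₃)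
    (h24 : s₂ ≠ s₄) (h34 : s₃ ≠ s₄) (hs₁ : ends s₁ = s(y, u₁)) (hs₂ : ends s₂ = s(y, u₂))
    (hs₃ : ends s₃ = s(y, u₃)) (hs₄ : ends s₄ = s(y, u₄)) (hyu₁ : y ≠ u₁) (hyu₂ : y ≠ u₂)
    (hyu₃ : y ≠ u₃) (hyu₄ : y ≠ u₄) (hyo : y ≠ o) (hy1 : y ≠ a₁) (hy2 : y ≠ a₂) (hy3 : y ≠ a₃)
    (hyb : y ≠ b) {x : Config E}
    (hcl : ∀ g, g ≠ s₁ → g ≠ s₂ → g ≠ s₃ → g ≠ s₄ → y ∈ ends g → (ends g).IsDiag ∨ x g = false)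
    {U : Bool × Bool × Bool × Bool}
    (hU : U = (true, false, false, false) ∨ U = (false, true, false, false) ∨
      U = (false, false, true, false) ∨ U = (false, false, false, true)) :
    st ends o a₁ a₂ a₃ b (starSet4 s₁ s₂ s₃ s₄ U x) =
      st ends o a₁ a₂ a₃ b (starSet4 s₁ s₂ s₃ s₄ (false, false, false, false) x) := by
  have hS := starSet4_apply h12 h13 h14 h23 h24 h34
  rcases hU with hU | hU | hU | hU
  · subst hU
    rw [StarPattern.st_update_false_pendant ends o a₁ a₂ a₃ b hs₁ hyu₁
      (ω := starSet4 s₁ s₂ s₃ s₄ (true, false, false, false) x) ?_ hyo hy1 hy2 hy3 hyb,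
      update_starSet4_one h12 h13 h14 h23 h24 h34 x]
    intro g hg hyg
    by_cases hg2 : g = s₂
    · subst hg2; right; simp [hS, h12.symm]
    by_cases hg3 : g = s₃
    · subst hg3; right; simp [hS, h13.symm, h23.symm]
    by_cases hg4 : g = s₄
    · subst hg4; right; simp [hS, h14.symm, h24.symm, h34.symm]
    rcases hcl g hg hg2 hg3 hg4 hyg with hd | hc
    · exact Or.inl hd
    · right; simp [hS, hg, hg2, hg3, hg4, hc]
  · subst hU
    rw [StarPattern.st_update_false_pendant ends o a₁ a₂ a₃ b hs₂ hyu₂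
      (ω := starSet4 s₁ s₂ s₃ s₄ (false, true, false, false) x) ?_ hyo hy1 hy2 hy3 hyb,
      update_starSet4_two h12 h13 h14 h23 h24 h34 x]
    intro g hg hyg
    by_cases hg1 : g = s₁
    · subst hg1; right; simp [hS]
    by_cases hg3 : g = s₃
    · subst hg3; right; simp [hS, h13.symm, h23.symm]
    by_cases hg4 : g = s₄
    · subst hg4; right; simp [hS, h14.symm, h24.symm, h34.symm]
    rcases hcl g hg1 hg hg3 hg4 hyg with hd | hc
    · exact Or.inl hd
    · right; simp [hS, hg, hg1, hg3, hg4, hc]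
  · subst hU
    rw [StarPattern.st_update_false_pendant ends o a₁ a₂ a₃ b hs₃ hyu₃
      (ω := starSet4 s₁ s₂ s₃ s₄ (false, false, true, false) x) ?_ hyo hy1 hy2 hy3 hyb,
      update_starSet4_three h12 h13 h14 h23 h24 h34 x]
    intro g hg hyg
    by_cases hg1 : g = s₁
    · subst hg1; right; simp [hS]
    by_cases hg2 : g = s₂
    · subst hg2; right; simp [hS, h12.symm]
    by_cases hg4 : g = s₄
    · subst hg4; right; simp [hS, h14.symm, h24.symm, h34.symm]
    rcases hcl g hg1 hg2 hg hg4 hyg with hd | hc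
    · exact Or.inl hd
    · right; simp [hS, hg, hg1, hg2, hg4, hc]
  · subst hU
    rw [StarPattern.st_update_false_pendant ends o a₁ a₂ a₃ b hs₄ hyu₄
      (ω := starSet4 s₁ s₂ s₃ s₄ (false, false, false, true) x) ?_ hyo hy1 hy2 hy3 hyb,
      update_starSet4_four h12 h13 h14 h23 h24 h34 x]
    intro g hg hyg
    by_cases hg1 : g = s₁
    · subst hg1; right; simp [hS]
    by_cases hg2 : g = s₂
    · subst hg2; right; simp [hS, h12.symm]
    by_cases hg3 : g = s₃
    · subst hg3; right; simp [hS, h13.symm, h23.symm]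
    rcases hcl g hg1 hg2 hg3 hg hyg with hd | hc
    · exact Or.inl hd
    · right; simp [hS, hg, hg1, hg2, hg3, hc]

end Close

/-! ## The star data and the closure of a pendant copy of a pattern count -/

section PatCount

variable {V : Type*} {E : Type*} [Fintype E] [DecidableEq E] {R : Type*} [Field R]

/-- The standing data of a degree-four star at the unmarked vertex `y`, with the star removed from
the typed set `F₀` and pinned closed in `z₀`, every other edge at `y` a loop or pinned closed. -/
structure StarData4 (ends : E → Sym2 V) (o a₁ a₂ a₃ b : V) (s₁ s₂ s₃ s₄ : E) (y u₁ u₂ u₃ u₄ : V)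
    (F₀ : Finset E) (z₀ : Config E) : Prop where
  h12 : s₁ ≠ s₂
  h13 : s₁ ≠ s₃
  h14 : s₁ ≠ s₄
  h23 : s₂ ≠ s₃
  h24 : s₂ ≠ s₄
  h34 : s₃ ≠ s₄
  hs₁ : ends s₁ = s(y, u₁)
  hs₂ : ends s₂ = s(y, u₂)
  hs₃ : ends s₃ = s(y, u₃)
  hs₄ : ends s₄ = s(y, u₄)
  hyu₁ : y ≠ u₁
  hyu₂ : y ≠ u₂
  hyu₃ : y ≠ u₃
  hyu₄ : y ≠ u₄
  hyo : y ≠ o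
  hy1 : y ≠ a₁
  hy2 : y ≠ a₂
  hy3 : y ≠ a₃
  hyb : y ≠ b
  hF₁ : s₁ ∉ F₀
  hF₂ : s₂ ∉ F₀
  hF₃ : s₃ ∉ F₀
  hF₄ : s₄ ∉ F₀
  hcl : ∀ g, g ≠ s₁ → g ≠ s₂ → g ≠ s₃ → g ≠ s₄ → y ∈ ends g →
    (ends g).IsDiag ∨ (g ∉ F₀ ∧ z₀ g = false)

variable {ends : E → Sym2 V} {o a₁ a₂ a₃ b : V} {s₁ s₂ s₃ s₄ : E} {y u₁ u₂ u₃ u₄ : V}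
  {F₀ : Finset E} {z₀ : Config E}

omit [Fintype E] [DecidableEq E] in
/-- On a counted configuration every non-star edge at `y` is a loop or closed. -/
lemma StarData4.closed_at (D : StarData4 ends o a₁ a₂ a₃ b s₁ s₂ s₃ s₄ y u₁ u₂ u₃ u₄ F₀ z₀)
    {x : Config E} (hx : ∀ e, e ∉ F₀ → x e = z₀ e) :
    ∀ g, g ≠ s₁ → g ≠ s₂ → g ≠ s₃ → g ≠ s₄ → y ∈ ends g → (ends g).IsDiag ∨ x g = false := by
  intro g hg1 hg2 hg3 hg4 hyg
  rcases D.hcl g hg1 hg2 hg3 hg4 hyg with hd | ⟨hgF, hz⟩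
  · exact Or.inl hd
  · exact Or.inr ((hx g hgF).trans hz)

/-- The singleton patterns. -/
def IsSingle (U : Bool × Bool × Bool × Bool) : Prop :=
  U = (true, false, false, false) ∨ U = (false, true, false, false) ∨
    U = (false, false, true, false) ∨ U = (false, false, false, true)

/-- **Closing a pendant first copy.** -/
theorem patCount4_close_x (D : StarData4 ends o a₁ a₂ a₃ b s₁ s₂ s₃ s₄ y u₁ u₂ u₃ u₄ F₀ z₀)
    (τ : E → ℕ) {U₀ : Bool × Bool × Bool × Bool} (hU : IsSingle U₀)
    (U₁ U₂ : Bool × Bool × Bool × Bool) :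
    patCount4 (R := R) ends o a₁ a₂ a₃ b s₁ s₂ s₃ s₄ F₀ z₀ τ U₀ U₁ U₂ =
      patCount4 ends o a₁ a₂ a₃ b s₁ s₂ s₃ s₄ F₀ z₀ τ (false, false, false, false) U₁ U₂ := by
  unfold patCount4 patKernel4
  refine StarPattern.typedCount_congr_on F₀ z₀ τ fun x y' w hpin _ => ?_
  rw [K3_eq_KB, K3_eq_KB, st_starSet4_single ends o a₁ a₂ a₃ b D.h12 D.h13 D.h14 D.h23 D.h24 D.h34
    D.hs₁ D.hs₂ D.hs₃ D.hs₄ D.hyu₁ D.hyu₂ D.hyu₃ D.hyu₄ D.hyo D.hy1 D.hy2 D.hy3 D.hyb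
    (D.closed_at fun e he => (hpin e he).1) hU]

/-- **Closing a pendant second copy.** -/
theorem patCount4_close_y (D : StarData4 ends o a₁ a₂ a₃ b s₁ s₂ s₃ s₄ y u₁ u₂ u₃ u₄ F₀ z₀)
    (τ : E → ℕ) (U₀ : Bool × Bool × Bool × Bool) {U₁ : Bool × Bool × Bool × Bool}
    (hU : IsSingle U₁) (U₂ : Bool × Bool × Bool × Bool) :
    patCount4 (R := R) ends o a₁ a₂ a₃ b s₁ s₂ s₃ s₄ F₀ z₀ τ U₀ U₁ U₂ =
      patCount4 ends o a₁ a₂ a₃ b s₁ s₂ s₃ s₄ F₀ z₀ τ U₀ (false, false, false, false) U₂ := by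
  unfold patCount4 patKernel4
  refine StarPattern.typedCount_congr_on F₀ z₀ τ fun x y' w hpin _ => ?_
  rw [K3_eq_KB, K3_eq_KB, st_starSet4_single ends o a₁ a₂ a₃ b D.h12 D.h13 D.h14 D.h23 D.h24 D.h34
    D.hs₁ D.hs₂ D.hs₃ D.hs₄ D.hyu₁ D.hyu₂ D.hyu₃ D.hyu₄ D.hyo D.hy1 D.hy2 D.hy3 D.hyb
    (D.closed_at fun e he => (hpin e he).2.1) hU]

/-- **Closing a pendant third copy.** -/
theorem patCount4_close_w (D : StarData4 ends o a₁ a₂ a₃ b s₁ s₂ s₃ s₄ y u₁ u₂ u₃ u₄ F₀ z₀)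
    (τ : E → ℕ) (U₀ U₁ : Bool × Bool × Bool × Bool) {U₂ : Bool × Bool × Bool × Bool}
    (hU : IsSingle U₂) :
    patCount4 (R := R) ends o a₁ a₂ a₃ b s₁ s₂ s₃ s₄ F₀ z₀ τ U₀ U₁ U₂ =
      patCount4 ends o a₁ a₂ a₃ b s₁ s₂ s₃ s₄ F₀ z₀ τ U₀ U₁ (false, false, false, false) := by
  unfold patCount4 patKernel4
  refine StarPattern.typedCount_congr_on F₀ z₀ τ fun x y' w hpin _ => ?_
  rw [K3_eq_KB, K3_eq_KB, st_starSet4_single ends o a₁ a₂ a₃ b D.h12 D.h13 D.h14 D.h23 D.h24 D.h34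
    D.hs₁ D.hs₂ D.hs₃ D.hs₄ D.hyu₁ D.hyu₂ D.hyu₃ D.hyu₄ D.hyo D.hy1 D.hy2 D.hy3 D.hyb
    (D.closed_at fun e he => (hpin e he).2.2) hU]

end PatCount

/-! ## The 81-placement split -/

section Split

variable {V : Type*} {E : Type*} [Fintype E] [DecidableEq E] {R : Type*} [Field R]

open StarPattern in
/-- **The star split**: with the four star edges of type `1`, the typed count is the sum over the
`81` placements of the pattern counts. -/
theorem typedCount_star4_split (ends : E → Sym2 V) (o a₁ a₂ a₃ b : V) {s₁ s₂ s₃ s₄ : E}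
    (h12 : s₁ ≠ s₂) (h13 : s₁ ≠ s₃) (h14 : s₁ ≠ s₄) (h23 : s₂ ≠ s₃) (h24 : s₂ ≠ s₄) (h34 : s₃ ≠ s₄)
    (F : Finset E) (hs₁ : s₁ ∈ F) (hs₂ : s₂ ∈ F) (hs₃ : s₃ ∈ F) (hs₄ : s₄ ∈ F) (z : Config E)
    (τ : E → ℕ) (hτ₁ : τ s₁ = 1) (hτ₂ : τ s₂ = 1) (hτ₃ : τ s₃ = 1) (hτ₄ : τ s₄ = 1) :
    typedCount F z τ (K3 ends o a₁ a₂ a₃ b : Config E → Config E → Config E → R) =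
      ∑ p₁ ∈ placements, ∑ p₂ ∈ placements, ∑ p₃ ∈ placements, ∑ p₄ ∈ placements,
        patCount4 ends o a₁ a₂ a₃ b s₁ s₂ s₃ s₄ ((((F.erase s₁).erase s₂).erase s₃).erase s₄)
          (Function.update (Function.update (Function.update (Function.update z s₁ false) s₂ false)
            s₃ false) s₄ false) τ
          (p₁.1, p₂.1, p₃.1, p₄.1) (p₁.2.1, p₂.2.1, p₃.2.1, p₄.2.1)
          (p₁.2.2, p₂.2.2, p₃.2.2, p₄.2.2) := by
  have hs₂' : s₂ ∈ F.erase s₁ := Finset.mem_erase.mpr ⟨h12.symm, hs₂⟩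
  have hs₃' : s₃ ∈ (F.erase s₁).erase s₂ :=
    Finset.mem_erase.mpr ⟨h23.symm, Finset.mem_erase.mpr ⟨h13.symm, hs₃⟩⟩
  have hs₄' : s₄ ∈ ((F.erase s₁).erase s₂).erase s₃ :=
    Finset.mem_erase.mpr ⟨h34.symm, Finset.mem_erase.mpr ⟨h24.symm,
      Finset.mem_erase.mpr ⟨h14.symm, hs₄⟩⟩⟩
  rw [typedCount_split F s₁ hs₁ z τ]
  simp only [hτ₁, sum_bool3_one]
  simp only [typedCount_split (F.erase s₁) s₂ hs₂', hτ₂, sum_bool3_one]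
  simp only [typedCount_split ((F.erase s₁).erase s₂) s₃ hs₃', hτ₃, sum_bool3_one]
  simp only [typedCount_split (((F.erase s₁).erase s₂).erase s₃) s₄ hs₄', hτ₄, sum_bool3_one]
  simp only [sum_placements]
  unfold patCount4 patKernel4 starSet4
  simp only []

end Split

end StarFour

end Summit.Ventures.PercRepro2
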